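import Mathlib

/-!
# Route `GreenTaoLevelTwo`, crux `MNTwo` (stmt-Parity-21276), line `birth`, stub `stub_mnVertical`:
# replacing one cutoff by its Fourier approximation and pigeonholing a character (GT 2008b §10)

Tool for block V4 / H3 (= AIF §10 Lemma 24 "Type II sum implies major arc", the step "Using Lemma
(fourier-lip), we can approximate `Ψ` uniformly to accuracy `O(δ)` … by a linear combination of at
most `O(δ^{-C})` characters … The coefficients in this linear combination are all `O(1)`.  Thus we
can estimate the left-hand side of (llm) by
`O(δ^{-C} sup_χ |∑ … χ(…) …|) + O(δL²M²)`.  Choosing `δ` suitably small, we thus conclude that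
there exist `χ` and `k` such that the inner sum is `≳ L²M²`") of the `stub_mnVertical` census
(B. Green, T. Tao, *Quadratic uniformity of the Möbius function*, Ann. Inst. Fourier 58 (2008) =
arXiv:math/0606087, §10).  Def-free and fully abstract (any finite index set): a weighted sum
`∑ W(i) a(i) g(i)` with real weights `|W| ≤ B₀`, `‖g‖ ≤ 1`, and `a` uniformly `δ`-approximated by
`∑_{j<J} c_j e_j(i)` with `‖c_j‖ ≤ C`, is large only if one of the sums `∑ W(i) e_j(i) g(i)` is.

* `exists_large_character` — the step quoted above:
  `∃ j < J, (Y − δB₀#s)/(J·C) ≤ ‖∑ W e_j g‖`.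

References: [GreenTao2008QuadraticMobius] arXiv:math/0606087 §10 (proof of Lemma 24), App. A
Lemma 37.
-/

open Finset

namespace Summit.Parity.GeneralizedHardyLittlewood.GreenTaoLevelTwoMNTwoFourierReplace

/-- **Fourier replacement of one cutoff and pigeonholing of a character.**  Let `s` be a finite
index set, `W : s → ℝ` with `|W| ≤ B₀`, `g : s → ℂ` with `‖g‖ ≤ 1`, `a : s → ℂ` with
`‖a(i) − ∑_{j<J} c_j e_j(i)‖ ≤ δ` on `s`, `‖c_j‖ ≤ C` (`C > 0`, `J ≥ 1`).  If
`Y ≤ ‖∑_{i∈s} W(i) a(i) g(i)‖` then some `j < J` has `(Y − δ B₀ #s)/(J C) ≤ ‖∑_{i∈s} W(i) e_j(i) g(i)‖`.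
[cite: GreenTao2008QuadraticMobius, §10 (proof of Lemma 24, the use of Lemma 37)] -/
theorem exists_large_character {ι : Type*} (s : Finset ι) (W : ι → ℝ) (g a : ι → ℂ)
    {B₀ δ Y C : ℝ} (hW : ∀ i ∈ s, |W i| ≤ B₀) (hg : ∀ i ∈ s, ‖g i‖ ≤ 1) {J : ℕ} (hJ : 1 ≤ J)
    (c : ℕ → ℂ) (hc : ∀ j ∈ range J, ‖c j‖ ≤ C) (hC : 0 < C) (e : ℕ → ι → ℂ)
    (happrox : ∀ i ∈ s, ‖a i - ∑ j ∈ range J, c j * e j i‖ ≤ δ)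
    (hY : Y ≤ ‖∑ i ∈ s, (W i : ℂ) * a i * g i‖) :
    ∃ j ∈ range J, (Y - δ * B₀ * #s) / (J * C) ≤ ‖∑ i ∈ s, (W i : ℂ) * e j i * g i‖ := by
  have hB₀ : ∀ i ∈ s, 0 ≤ B₀ := fun i hi => (abs_nonneg _).trans (hW i hi)
  -- split `a = (a − approx) + approx`
  set r : ι → ℂ := fun i => a i - ∑ j ∈ range J, c j * e j i with hr
  have hsplit : ∑ i ∈ s, (W i : ℂ) * a i * g i =
      ∑ i ∈ s, (W i : ℂ) * r i * g i +
        ∑ j ∈ range J, c j * ∑ i ∈ s, (W i : ℂ) * e j i * g i := by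
    have h2 : ∑ j ∈ range J, c j * ∑ i ∈ s, (W i : ℂ) * e j i * g i =
        ∑ i ∈ s, ∑ j ∈ range J, c j * ((W i : ℂ) * e j i * g i) := by
      rw [Finset.sum_comm]
      exact Finset.sum_congr rfl fun j _ => Finset.mul_sum _ _ _
    rw [h2, ← Finset.sum_add_distrib]
    refine Finset.sum_congr rfl fun i _ => ?_
    have hS : ∑ j ∈ range J, c j * ((W i : ℂ) * e j i * g i) =
        (W i : ℂ) * (∑ j ∈ range J, c j * e j i) * g i := by
      rw [Finset.mul_sum, Finset.sum_mul]
      exact Finset.sum_congr rfl fun j _ => by ring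
    rw [hS, hr]
    ring
  -- the error term
  have herr : ‖∑ i ∈ s, (W i : ℂ) * r i * g i‖ ≤ δ * B₀ * #s := by
    calc ‖∑ i ∈ s, (W i : ℂ) * r i * g i‖ ≤ ∑ i ∈ s, ‖(W i : ℂ) * r i * g i‖ := norm_sum_le _ _
      _ ≤ ∑ i ∈ s, δ * B₀ := by
          refine Finset.sum_le_sum fun i hi => ?_
          rw [norm_mul, norm_mul, Complex.norm_real, Real.norm_eq_abs]
          have h1 := hW i hi
          have h2 := happrox i hi
          have h3 := hg i hi
          have hδ : 0 ≤ δ := (norm_nonneg _).trans h2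
          calc |W i| * ‖r i‖ * ‖g i‖ ≤ B₀ * δ * 1 :=
                mul_le_mul (mul_le_mul h1 h2 (norm_nonneg _) (hB₀ i hi)) h3 (norm_nonneg _)
                  (mul_nonneg (hB₀ i hi) hδ)
            _ = δ * B₀ := by ring
      _ = δ * B₀ * #s := by rw [Finset.sum_const, nsmul_eq_mul]; ring
  -- the main term is large
  have hmain : Y - δ * B₀ * #s ≤ ∑ j ∈ range J, C * ‖∑ i ∈ s, (W i : ℂ) * e j i * g i‖ := by
    have h1 : ‖∑ i ∈ s, (W i : ℂ) * a i * g i‖ ≤ ‖∑ i ∈ s, (W i : ℂ) * r i * g i‖ +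
        ‖∑ j ∈ range J, c j * ∑ i ∈ s, (W i : ℂ) * e j i * g i‖ := by
      rw [hsplit]; exact norm_add_le _ _
    have h2 : ‖∑ j ∈ range J, c j * ∑ i ∈ s, (W i : ℂ) * e j i * g i‖ ≤
        ∑ j ∈ range J, C * ‖∑ i ∈ s, (W i : ℂ) * e j i * g i‖ := by
      refine (norm_sum_le _ _).trans (Finset.sum_le_sum fun j hj => ?_)
      rw [norm_mul]
      exact mul_le_mul_of_nonneg_right (hc j hj) (norm_nonneg _)
    linarith
  -- pigeonhole over `j`
  have hne : (range J).Nonempty := ⟨0, by rw [Finset.mem_range]; omega⟩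
  have hconst : ∑ _j ∈ range J, (Y - δ * B₀ * #s) / (J * C) * C ≤
      ∑ j ∈ range J, C * ‖∑ i ∈ s, (W i : ℂ) * e j i * g i‖ := by
    rw [Finset.sum_const, Finset.card_range, nsmul_eq_mul]
    have hJr : (0 : ℝ) < J := by exact_mod_cast hJ
    have e1 : (J : ℝ) * ((Y - δ * B₀ * #s) / (J * C) * C) = Y - δ * B₀ * #s := by
      field_simp
    rw [e1]; exact hmain
  obtain ⟨j, hj, hle⟩ := Finset.exists_le_of_sum_le hne hconst
  refine ⟨j, hj, ?_⟩
  have := hle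
  rw [mul_comm C] at this
  exact le_of_mul_le_mul_right this hC

end Summit.Parity.GeneralizedHardyLittlewood.GreenTaoLevelTwoMNTwoFourierReplace
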